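import Mathlib
import Summits.Ventures.PercRepro2.CoinKSureGate
import Summits.Ventures.PercRepro2.CoinChainMixLsm
import Summits.Ventures.PercRepro2.CoinChainWorld1
import Summits.Ventures.PercRepro2.CoinChainStar

/-!
# The A-world decomposition of the pure AND-switch chain — the lemmas
(blind cell PercRepro2, night-2 g19; proofs/NIGHT2-DARC.md §59)

Pure chain (§58.1): `a'` entered from `ent' ⊆ U` by sure coins, `a` from `a'` alone by the coin
`ρ`; head values `c` (closure of `W`), `d = c(· + a)`, `d' = c(· + a + w)`; the κ-integrated
`R`-law is `ν · chainMix ∅ ent' ρ c d`, the gate `ν · chainMix ∅ ent' ρ c d'`.  Instead of the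
chain coin (§58), split by whether `a` reaches the target IN THE HEAD (the event `A`):
`chainMix ρ c d = (1 − θ)(c − d) + d` and `chainMix ρ c d' = (1 − θ)(c − d) + chainMix ρ d d'`
with `θ = chainTheta ∅ ent' ρ`.  World `A` (weight `(1 − θ)(c − d)`, `c − d = P(· ↛ T, a ⇝ T)`)
has no pivotality; world `Ā` has the `R`-law `d` (no coin) and the OR-tail gate
`chainMix ρ d d'`.  Three of the four terms of (★) are nonnegative for every head; the
fourth (the covariance of the `A`-law) needs `c − d` log-supermodular, a structural hypothesis
on the head (see `CoinChainAWorld.lean`).  This file holds the lemmas: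

* `cross_cd` — the 2×2 inequality `(c s − d s) · e t ≤ (c (s ∩ t) − d (s ∩ t)) · e (s ∪ t)`
  for `d, e ≤ c` with `d / c`, `e / c` increasing and `c` log-supermodular;
* `aw_holley_sums`, `aw_fkg_sums` — Holley and FKG in cleared form from `ad_pointwise`;
* `aw_cross_AR`, `aw_cross_AG`, `aw_cross_GR` — the pointwise Holley conditions
  `A ≼ Ā`, `A ≼ Ā-gate`, and the OR-tail condition of the `Ā`-pair;
* `one_sub_theta_facts`, `chainMix_dd'_le`, `chainMix_dd'_nonneg` — the coin weights;
* `aw_T01_nonneg`, `aw_assemble` — the algebra in the eleven moments: (★)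
  (`chain_star_nonneg'` at mixing parameter `1/2`) with every term nonnegative.

The theorem `pureChain_functional_nonneg` is in `CoinChainAWorld.lean`.
-/

namespace Summit.Ventures.PercRepro2.Coin

section ChainAWorld

variable {V : Type*} [DecidableEq V] {R : Type*} [Field R] [LinearOrder R] [IsStrictOrderedRing R]

/-- **The cross inequality (X1).** For `c` log-supermodular, `d, e ≤ c` with `d / c` and
`e / c` increasing: `(c s − d s) · e t ≤ (c (s ∩ t) − d (s ∩ t)) · e (s ∪ t)`.  (In the head,
with `e = d`: `P(s ↛ T, a ⇝ T) · P(t + a ↛ T) ≤ P(s ∩ t ↛ T, a ⇝ T) · P(s ∪ t + a ↛ T)`.) -/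
lemma cross_cd (c d e : Finset V → R) (hc0 : ∀ W, 0 ≤ c W) (hd0 : ∀ W, 0 ≤ d W)
    (he0 : ∀ W, 0 ≤ e W) (hdc : ∀ W, d W ≤ c W) (hec : ∀ W, e W ≤ c W)
    (hcc : ∀ s t, c s * c t ≤ c (s ∩ t) * c (s ∪ t))
    (hratio : ∀ s t, s ⊆ t → d s * c t ≤ c s * d t)
    (hratio_e : ∀ s t, s ⊆ t → e s * c t ≤ c s * e t) (s t : Finset V) :
    (c s - d s) * e t ≤ (c (s ∩ t) - d (s ∩ t)) * e (s ∪ t) := by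
  have hL := hcc s t
  have hR1 := hratio (s ∩ t) s Finset.inter_subset_left
  have hR4 := hratio_e t (s ∪ t) Finset.subset_union_right
  have hA0 := hc0 (s ∩ t); have hB0 := hc0 s; have hC0 := hc0 t; have hD0 := hc0 (s ∪ t)
  have hC'0 := he0 t; have hD'0 := he0 (s ∪ t)
  have hAA' := hdc (s ∩ t); have hBB' := hdc s
  have hY : 0 ≤ (c (s ∩ t) - d (s ∩ t)) * e (s ∪ t) := mul_nonneg (by linarith) hD'0
  by_cases hAD : c (s ∩ t) * c (s ∪ t) = 0
  · have h0 : c s * c t = 0 := le_antisymm (by rw [← hAD]; exact hL) (mul_nonneg hB0 hC0)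
    rcases mul_eq_zero.mp h0 with h | h
    · have hds : d s = 0 := le_antisymm (by rw [← h]; exact hdc s) (hd0 s)
      rw [h, hds]; simpa using hY
    · have het : e t = 0 := le_antisymm (by rw [← h]; exact hec t) (he0 t)
      rw [het]; simpa using hY
  · have hADpos : 0 < c (s ∩ t) * c (s ∪ t) :=
      lt_of_le_of_ne (mul_nonneg hA0 hD0) (Ne.symm hAD)
    have h1 : (c s - d s) * c (s ∩ t) ≤ (c (s ∩ t) - d (s ∩ t)) * c s := by nlinarith [hR1]
    have hprod : ((c s - d s) * c (s ∩ t)) * (e t * c (s ∪ t)) ≤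
        ((c (s ∩ t) - d (s ∩ t)) * c s) * (c t * e (s ∪ t)) :=
      mul_le_mul h1 hR4 (mul_nonneg hC'0 hD0) (mul_nonneg (by linarith) hB0)
    have hY' : (c (s ∩ t) - d (s ∩ t)) * e (s ∪ t) * (c s * c t) ≤
        (c (s ∩ t) - d (s ∩ t)) * e (s ∪ t) * (c (s ∩ t) * c (s ∪ t)) :=
      mul_le_mul_of_nonneg_left hL hY
    have key : (c s - d s) * e t * (c (s ∩ t) * c (s ∪ t)) ≤
        (c (s ∩ t) - d (s ∩ t)) * e (s ∪ t) * (c (s ∩ t) * c (s ∪ t)) := by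
      calc (c s - d s) * e t * (c (s ∩ t) * c (s ∪ t))
          = ((c s - d s) * c (s ∩ t)) * (e t * c (s ∪ t)) := by ring
        _ ≤ ((c (s ∩ t) - d (s ∩ t)) * c s) * (c t * e (s ∪ t)) := hprod
        _ = (c (s ∩ t) - d (s ∩ t)) * e (s ∪ t) * (c s * c t) := by ring
        _ ≤ _ := hY'
    exact le_of_mul_le_mul_right key hADpos

/-- Holley comparison in cleared form on `U.powerset`, from the four functions theorem:
if `μ₁ s · μ₂ t ≤ μ₁ (s ∩ t) · μ₂ (s ∪ t)` then the mean of an increasing nonnegative `x` under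
`μ₂` dominates its mean under `μ₁`. -/
lemma aw_holley_sums (U : Finset V) (μ₁ μ₂ x : Finset V → R) (h1 : ∀ W, 0 ≤ μ₁ W)
    (h2 : ∀ W, 0 ≤ μ₂ W) (hx0 : ∀ W, 0 ≤ x W) (hxm : ∀ s t, x s ≤ x (s ∪ t))
    (hdom : ∀ s ⊆ U, ∀ t ⊆ U, μ₁ s * μ₂ t ≤ μ₁ (s ∩ t) * μ₂ (s ∪ t)) :
    (∑ W ∈ U.powerset, μ₁ W * x W) * (∑ W ∈ U.powerset, μ₂ W) ≤
      (∑ W ∈ U.powerset, μ₁ W) * (∑ W ∈ U.powerset, μ₂ W * x W) := by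
  refine ad_pointwise U (fun W => μ₁ W * x W) μ₂ μ₁ (fun W => μ₂ W * x W)
    (fun W => mul_nonneg (h1 W) (hx0 W)) h2 h1 (fun W => mul_nonneg (h2 W) (hx0 W)) ?_
  intro s hs t ht
  calc μ₁ s * x s * μ₂ t = (μ₁ s * μ₂ t) * x s := by ring
    _ ≤ (μ₁ (s ∩ t) * μ₂ (s ∪ t)) * x (s ∪ t) :=
        mul_le_mul (hdom s hs t ht) (hxm s t) (hx0 s) (mul_nonneg (h1 _) (h2 _))
    _ = μ₁ (s ∩ t) * (μ₂ (s ∪ t) * x (s ∪ t)) := by ring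

/-- FKG in cleared form on `U.powerset`, from the four functions theorem. -/
lemma aw_fkg_sums (U : Finset V) (μ x y : Finset V → R) (hμ : ∀ W, 0 ≤ μ W)
    (hx0 : ∀ W, 0 ≤ x W) (hy0 : ∀ W, 0 ≤ y W)
    (hxm : ∀ s t, x s ≤ x (s ∪ t)) (hym : ∀ s t, y s ≤ y (s ∪ t))
    (hlsm : ∀ s ⊆ U, ∀ t ⊆ U, μ s * μ t ≤ μ (s ∩ t) * μ (s ∪ t)) :
    (∑ W ∈ U.powerset, μ W * x W) * (∑ W ∈ U.powerset, μ W * y W) ≤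
      (∑ W ∈ U.powerset, μ W) * (∑ W ∈ U.powerset, μ W * (x W * y W)) := by
  refine ad_pointwise U (fun W => μ W * x W) (fun W => μ W * y W) μ
    (fun W => μ W * (x W * y W)) (fun W => mul_nonneg (hμ W) (hx0 W))
    (fun W => mul_nonneg (hμ W) (hy0 W)) hμ
    (fun W => mul_nonneg (hμ W) (mul_nonneg (hx0 W) (hy0 W))) ?_
  intro s hs t ht
  have hyt : y t ≤ y (s ∪ t) := by rw [Finset.union_comm]; exact hym t s
  calc μ s * x s * (μ t * y t) = (μ s * μ t) * (x s * y t) := by ring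
    _ ≤ (μ (s ∩ t) * μ (s ∪ t)) * (x (s ∪ t) * y (s ∪ t)) :=
        mul_le_mul (hlsm s hs t ht)
          (mul_le_mul (hxm s t) hyt (hy0 t) (hx0 _)) (mul_nonneg (hx0 s) (hy0 t))
          (mul_nonneg (hμ _) (hμ _))
    _ = μ (s ∩ t) * (μ (s ∪ t) * (x (s ∪ t) * y (s ∪ t))) := by ring

omit [LinearOrder R] [IsStrictOrderedRing R] in
/-- The pure-chain coin weight: `chainTheta ∅ ent' ρ W = ρ` if `W` meets `ent'`, else `0`. -/
lemma chainTheta_empty (ent' : Finset V) (ρ : R) (W : Finset V) :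
    chainTheta ∅ ent' ρ W = if ∃ r ∈ ent', r ∈ W then ρ else 0 := by
  unfold chainTheta
  simp

/-- The `A`-weight `(1 − θ) · (c − d)` against the `Ā`-law `d` (pointwise Holley condition):
`(1 − θ s)(c s − d s) · d t ≤ (1 − θ (s ∩ t))(c (s ∩ t) − d (s ∩ t)) · d (s ∪ t)`. -/
lemma aw_cross_AR (ent' : Finset V) (ρ : R) (hρ0 : 0 ≤ ρ) (hρ1 : ρ ≤ 1)
    (c d : Finset V → R) (hc0 : ∀ W, 0 ≤ c W) (hd0 : ∀ W, 0 ≤ d W)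
    (hdc : ∀ W, d W ≤ c W) (hcc : ∀ s t, c s * c t ≤ c (s ∩ t) * c (s ∪ t))
    (hratio : ∀ s t, s ⊆ t → d s * c t ≤ c s * d t) (s t : Finset V) :
    (1 - chainTheta ∅ ent' ρ s) * (c s - d s) * d t ≤
      (1 - chainTheta ∅ ent' ρ (s ∩ t)) * (c (s ∩ t) - d (s ∩ t)) * d (s ∪ t) := by
  have hX := cross_cd c d d hc0 hd0 hd0 hdc hdc hcc hratio hratio s t
  have hX0 : 0 ≤ (c (s ∩ t) - d (s ∩ t)) * d (s ∪ t) :=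
    mul_nonneg (by linarith [hdc (s ∩ t)]) (hd0 _)
  have hρ' : (0 : R) ≤ 1 - ρ := by linarith
  rw [chainTheta_empty, chainTheta_empty]
  by_cases hs : ∃ r ∈ ent', r ∈ s <;> by_cases hi : ∃ r ∈ ent', r ∈ s ∩ t
  all_goals
    first
    | exact absurd (meets_inter_left hi) hs
    | skip
  all_goals simp only [hs, hi, if_true, if_false, sub_zero, one_mul]
  · nlinarith [mul_le_mul_of_nonneg_left hX hρ']
  · nlinarith [mul_le_mul_of_nonneg_left hX hρ']
  · nlinarith

/-- The `A`-weight `(1 − θ) · (c − d)` against the `Ā`-gate `chainMix ∅ ent' ρ d d'`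
(pointwise Holley condition): termwise from (X1) for `d` and for `d'`, with the coin weights
`1 − θ ∈ {1, 1 − ρ}` placed by the entry status of `s`, `t`, `s ∩ t`. -/
lemma aw_cross_AG (ent' : Finset V) (ρ : R) (hρ0 : 0 ≤ ρ) (hρ1 : ρ ≤ 1)
    (c d d' : Finset V → R) (hc0 : ∀ W, 0 ≤ c W) (hd0 : ∀ W, 0 ≤ d W)
    (hd'0 : ∀ W, 0 ≤ d' W) (hdc : ∀ W, d W ≤ c W) (hd'd : ∀ W, d' W ≤ d W)
    (hcc : ∀ s t, c s * c t ≤ c (s ∩ t) * c (s ∪ t))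
    (hratio : ∀ s t, s ⊆ t → d s * c t ≤ c s * d t)
    (hratio' : ∀ s t, s ⊆ t → d' s * c t ≤ c s * d' t) (s t : Finset V) :
    (1 - chainTheta ∅ ent' ρ s) * (c s - d s) * chainMix ∅ ent' ρ d d' t ≤
      (1 - chainTheta ∅ ent' ρ (s ∩ t)) * (c (s ∩ t) - d (s ∩ t)) *
        chainMix ∅ ent' ρ d d' (s ∪ t) := by
  have hX := cross_cd c d d hc0 hd0 hd0 hdc hdc hcc hratio hratio s t
  have hX' := cross_cd c d d' hc0 hd0 hd'0 hdc (fun W => le_trans (hd'd W) (hdc W)) hcc hratio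
    hratio' s t
  have hcd0 : 0 ≤ c (s ∩ t) - d (s ∩ t) := by linarith [hdc (s ∩ t)]
  have hY : 0 ≤ (c (s ∩ t) - d (s ∩ t)) * d (s ∪ t) := mul_nonneg hcd0 (hd0 _)
  have hY' : 0 ≤ (c (s ∩ t) - d (s ∩ t)) * d' (s ∪ t) := mul_nonneg hcd0 (hd'0 _)
  have hρ' : (0 : R) ≤ 1 - ρ := by linarith
  have hXρ := mul_le_mul_of_nonneg_left hX hρ'
  have hX'ρ := mul_le_mul_of_nonneg_left hX' hρ0
  have hXρρ := mul_le_mul_of_nonneg_left hXρ hρ'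
  have hX'ρρ := mul_le_mul_of_nonneg_left hX'ρ hρ'
  unfold chainMix
  rw [chainTheta_empty, chainTheta_empty, chainTheta_empty, chainTheta_empty]
  by_cases hs : ∃ r ∈ ent', r ∈ s <;> by_cases ht : ∃ r ∈ ent', r ∈ t <;>
    by_cases hi : ∃ r ∈ ent', r ∈ s ∩ t
  all_goals
    first
    | exact absurd (meets_inter_left hi) hs
    | exact absurd (meets_inter_right hi) ht
    | skip
  all_goals
    have hu : (∃ r ∈ ent', r ∈ s ∪ t) ↔ (∃ r ∈ ent', r ∈ s) ∨ (∃ r ∈ ent', r ∈ t) :=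
      meets_union_iff
    simp only [hs, ht, hi, hu, or_self, or_true, or_false, if_true, if_false,
      sub_zero, one_mul, zero_mul, add_zero]
  all_goals nlinarith [hXρ, hX'ρ, hXρρ, hX'ρρ, hY, hY', mul_nonneg hρ0 hY',
    mul_nonneg hρ' hY, mul_nonneg hρ0 hY, mul_nonneg (mul_nonneg hρ' hρ0) hY']

/-- `chainMix ∅ ent' ρ d d' ≤ d` when `d' ≤ d`. -/
lemma chainMix_dd'_le (ent' : Finset V) (ρ : R) (hρ0 : 0 ≤ ρ)
    (d d' : Finset V → R) (hd'd : ∀ W, d' W ≤ d W) (W : Finset V) :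
    chainMix ∅ ent' ρ d d' W ≤ d W := by
  unfold chainMix
  rw [chainTheta_empty]
  split_ifs
  · nlinarith [hd'd W]
  · simp

/-- `chainMix ∅ ent' ρ d d' ≥ 0`. -/
lemma chainMix_dd'_nonneg (ent' : Finset V) (ρ : R) (hρ0 : 0 ≤ ρ) (hρ1 : ρ ≤ 1)
    (d d' : Finset V → R) (hd0 : ∀ W, 0 ≤ d W) (hd'0 : ∀ W, 0 ≤ d' W) (W : Finset V) :
    0 ≤ chainMix ∅ ent' ρ d d' W := by
  unfold chainMix
  rw [chainTheta_empty]
  split_ifs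
  · nlinarith [hd0 W, hd'0 W]
  · simp [hd0 W]

/-- The coin weight `1 − chainTheta ∅ ent' ρ` lies in `[0, 1]`, is decreasing, and is
log-supermodular. -/
lemma one_sub_theta_facts (ent' : Finset V) (ρ : R) (hρ0 : 0 ≤ ρ) (hρ1 : ρ ≤ 1) :
    (∀ W, 0 ≤ 1 - chainTheta ∅ ent' ρ W) ∧
    (∀ s t, 1 - chainTheta ∅ ent' ρ s ≤ 1 - chainTheta ∅ ent' ρ (s ∩ t)) ∧
    (∀ s t, (1 - chainTheta ∅ ent' ρ s) * (1 - chainTheta ∅ ent' ρ t) ≤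
      (1 - chainTheta ∅ ent' ρ (s ∩ t)) * (1 - chainTheta ∅ ent' ρ (s ∪ t))) := by
  refine ⟨fun W => ?_, fun s t => ?_, fun s t => ?_⟩
  · rw [chainTheta_empty]; split_ifs <;> linarith
  · rw [chainTheta_empty, chainTheta_empty]
    by_cases hs : ∃ r ∈ ent', r ∈ s <;> by_cases hi : ∃ r ∈ ent', r ∈ s ∩ t
    all_goals
      first
      | exact absurd (meets_inter_left hi) hs
      | skip
    all_goals simp only [hs, hi, if_true, if_false] ; linarith
  · rw [chainTheta_empty, chainTheta_empty, chainTheta_empty, chainTheta_empty]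
    have hu : (∃ r ∈ ent', r ∈ s ∪ t) ↔ (∃ r ∈ ent', r ∈ s) ∨ (∃ r ∈ ent', r ∈ t) :=
      meets_union_iff
    by_cases hs : ∃ r ∈ ent', r ∈ s <;> by_cases ht : ∃ r ∈ ent', r ∈ t <;>
      by_cases hi : ∃ r ∈ ent', r ∈ s ∩ t
    all_goals
      first
      | exact absurd (meets_inter_left hi) hs
      | exact absurd (meets_inter_right hi) ht
      | skip
    all_goals
      simp only [hs, ht, hi, hu, or_self, or_true, or_false, if_true, if_false, sub_zero]
    all_goals nlinarith

/-- The Ā-gate centred at the A-means is nonnegative: from FKG for the gate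
(`g1 g2 ≤ g0 g12`) and the two Holley comparisons (`a1 g0 ≤ a0 g1`, `a2 g0 ≤ a0 g2`), in the
moments. -/
lemma aw_T01_nonneg (a0 a1 a2 g0 g1 g2 g12 : R) (hg0 : 0 ≤ g0) (hg1 : 0 ≤ g1) (hg2 : 0 ≤ g2)
    (hg12 : 0 ≤ g12) (hg1le : g1 ≤ g0) (hg2le : g2 ≤ g0) (hg12le : g12 ≤ g0)
    (hFG : g1 * g2 ≤ g0 * g12) (hH1 : a1 * g0 ≤ a0 * g1) (hH2 : a2 * g0 ≤ a0 * g2) :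
    0 ≤ a0 ^ 2 * g12 - a0 * a1 * g2 - a0 * a2 * g1 + a1 * a2 * g0 := by
  rcases eq_or_lt_of_le hg0 with h | h
  · have hg1z : g1 = 0 := le_antisymm (by rw [h]; exact hg1le) hg1
    have hg2z : g2 = 0 := le_antisymm (by rw [h]; exact hg2le) hg2
    have hg12z : g12 = 0 := le_antisymm (by rw [h]; exact hg12le) hg12
    rw [← h, hg1z, hg2z, hg12z]; ring_nf; exact le_refl _
  · have key : g0 * (a0 ^ 2 * g12 - a0 * a1 * g2 - a0 * a2 * g1 + a1 * a2 * g0) =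
        a0 ^ 2 * (g0 * g12 - g1 * g2) + (a0 * g1 - a1 * g0) * (a0 * g2 - a2 * g0) := by ring
    have hpos : 0 ≤ g0 * (a0 ^ 2 * g12 - a0 * a1 * g2 - a0 * a2 * g1 + a1 * a2 * g0) := by
      rw [key]
      exact add_nonneg (mul_nonneg (sq_nonneg _) (by linarith))
        (mul_nonneg (by linarith) (by linarith))
    exact (mul_nonneg_iff_of_pos_left h).mp hpos

/-- The assembly of (★) at mixing parameter `1/2` with the degenerate cases (no A-mass, no
Ā-mass), in the eleven moments: the cleared functional of the SUMS `a + b` (R-law) and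
`a + g` (gate) is nonnegative. -/
lemma aw_assemble (a0 a1 a2 a12 b0 b1 b2 g0 g1 g2 g12 : R)
    (ha0 : 0 ≤ a0) (ha1 : 0 ≤ a1) (ha2 : 0 ≤ a2) (ha12 : 0 ≤ a12)
    (ha1le : a1 ≤ a0) (ha2le : a2 ≤ a0) (ha12le : a12 ≤ a0)
    (hb0 : 0 ≤ b0) (hb1 : 0 ≤ b1) (hb2 : 0 ≤ b2) (hb1le : b1 ≤ b0) (hb2le : b2 ≤ b0)
    (hg0 : 0 ≤ g0) (hg1 : 0 ≤ g1) (hg2 : 0 ≤ g2) (hg12 : 0 ≤ g12)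
    (hg1le : g1 ≤ g0) (hg2le : g2 ≤ g0) (hg12le : g12 ≤ g0) (hgb : g0 ≤ b0)
    (hD : 0 ≤ a0 * a12 - a1 * a2)
    (hT01 : 0 ≤ a0 ^ 2 * g12 - a0 * a1 * g2 - a0 * a2 * g1 + a1 * a2 * g0)
    (hT11 : 0 ≤ b0 ^ 2 * g12 - b0 * b1 * g2 - b0 * b2 * g1 + b1 * b2 * g0)
    (hΔ : 0 ≤ (b0 * a1 - a0 * b1) * (b0 * a2 - a0 * b2)) :
    0 ≤ (a0 + b0) ^ 2 * (a12 + g12) - (a0 + b0) * (a1 + b1) * (a2 + g2)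
      - (a0 + b0) * (a2 + b2) * (a1 + g1) + (a1 + b1) * (a2 + b2) * (a0 + g0) := by
  rcases eq_or_lt_of_le ha0 with hA | hA
  · have ha1z : a1 = 0 := le_antisymm (by rw [hA]; exact ha1le) ha1
    have ha2z : a2 = 0 := le_antisymm (by rw [hA]; exact ha2le) ha2
    have ha12z : a12 = 0 := le_antisymm (by rw [hA]; exact ha12le) ha12
    rw [← hA, ha1z, ha2z, ha12z]
    simpa using hT11
  rcases eq_or_lt_of_le hb0 with hB | hB
  · have hb1z : b1 = 0 := le_antisymm (by rw [hB]; exact hb1le) hb1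
    have hb2z : b2 = 0 := le_antisymm (by rw [hB]; exact hb2le) hb2
    have hg0z : g0 = 0 := le_antisymm (by rw [hB]; exact hgb) hg0
    have hg1z : g1 = 0 := le_antisymm (hg1le.trans_eq hg0z) hg1
    have hg2z : g2 = 0 := le_antisymm (hg2le.trans_eq hg0z) hg2
    have hg12z : g12 = 0 := le_antisymm (hg12le.trans_eq hg0z) hg12
    rw [← hB, hb1z, hb2z, hg0z, hg1z, hg2z, hg12z]
    have e : (a0 + 0) ^ 2 * (a12 + 0) - (a0 + 0) * (a1 + 0) * (a2 + 0)
        - (a0 + 0) * (a2 + 0) * (a1 + 0) + (a1 + 0) * (a2 + 0) * (a0 + 0) =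
        a0 * (a0 * a12 - a1 * a2) := by ring
    rw [e]
    exact mul_nonneg ha0 hD
  have key := chain_star_nonneg' a0 a1 a2 a12 b0 b1 b2 g0 g1 g2 g12 (1 / 2) (by norm_num)
    (by norm_num) hA hB hgb hD hT01 hT11 hΔ
  have h8 : (a0 + b0) ^ 2 * (a12 + g12) - (a0 + b0) * (a1 + b1) * (a2 + g2)
      - (a0 + b0) * (a2 + b2) * (a1 + g1) + (a1 + b1) * (a2 + b2) * (a0 + g0)
      = 8 * (((1 - 1 / 2) * a0 + 1 / 2 * b0) ^ 2 * ((1 - 1 / 2) * a12 + 1 / 2 * g12)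
        - ((1 - 1 / 2) * a0 + 1 / 2 * b0) * ((1 - 1 / 2) * a1 + 1 / 2 * b1) *
          ((1 - 1 / 2) * a2 + 1 / 2 * g2)
        - ((1 - 1 / 2) * a0 + 1 / 2 * b0) * ((1 - 1 / 2) * a2 + 1 / 2 * b2) *
          ((1 - 1 / 2) * a1 + 1 / 2 * g1)
        + ((1 - 1 / 2) * a1 + 1 / 2 * b1) * ((1 - 1 / 2) * a2 + 1 / 2 * b2) *
          ((1 - 1 / 2) * a0 + 1 / 2 * g0)) := by ring
  rw [h8]
  exact mul_nonneg (by norm_num) key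

/-- The Ā-gate against the Ā-law, pointwise Holley condition for entered `s` (`wML` of
`gate_functional_nonneg`): `chainMix ρ d d' s · d t ≤ d (s ∩ t) · chainMix ρ d d' (s ∪ t)`. -/
lemma aw_cross_GR (ent' : Finset V) (ρ : R) (hρ0 : 0 ≤ ρ) (hρ1 : ρ ≤ 1)
    (d d' : Finset V → R) (hd0 : ∀ W, 0 ≤ d W) (hd'0 : ∀ W, 0 ≤ d' W)
    (hdd : ∀ s t, d s * d t ≤ d (s ∩ t) * d (s ∪ t))
    (hdd' : ∀ s t, d s * d' t ≤ d (s ∩ t) * d' (s ∪ t)) (s t : Finset V)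
    (hse : ∃ r ∈ ent', r ∈ s) :
    chainMix ∅ ent' ρ d d' s * d t ≤ d (s ∩ t) * chainMix ∅ ent' ρ d d' (s ∪ t) := by
  have hsu : ∃ r ∈ ent', r ∈ s ∪ t := by
    obtain ⟨r, hr, hrs⟩ := hse; exact ⟨r, hr, Finset.mem_union_left _ hrs⟩
  unfold chainMix
  rw [chainTheta_empty, chainTheta_empty, if_pos hse, if_pos hsu]
  have h1 := hdd s t
  have h2 : d' s * d t ≤ d (s ∩ t) * d' (s ∪ t) := by
    have := hdd' t s; rw [Finset.inter_comm, Finset.union_comm] at this; linarith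
  have hρ' : (0 : R) ≤ 1 - ρ := by linarith
  have e1 := mul_le_mul_of_nonneg_left h1 hρ'
  have e2 := mul_le_mul_of_nonneg_left h2 hρ0
  have hd0s := hd0 s; have hd'0s := hd'0 s; have hd0t := hd0 t
  nlinarith [e1, e2]

end ChainAWorld

end Summit.Ventures.PercRepro2.Coin
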